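import Mathlib
import HarnessLib

/-!
# ValiantsHypothesis / LacunarySymmetroid — crux `MatrixDescartes` (stmt-ValiantsHypothesis-18050, V1),
# LINE (A) «product_plus_one»: SPLIT-SIGNED companies at an INTERIOR coupling, every `K` — one-signed Euler letters and
# the INTERACTION LAW (every zero of the c-free Euler numerator needs a passed AND an ahead row)

Every-`K`, every-coupling twin of the `K = 3` middle-coupling structure ✓ `…ProductPlusOneMiddleLaurent`
(`euler_letter_middle_one_signed`) and of the bottom-coupling non-vanishing rows ✓ `eulerNumerator_eval_ne_zero_of_all_switched'` /
`…_of_all_unswitched'` (`K = 3`).  Setting: rows `f_j = Σ_l C a_{jl} X^{d_l}` on ANY support `d : Fin K → ℕ`, coupled letter `l₀`,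
c-free Euler numerator `R_{l₀} = Σ_j B_j · ∏_{i≠j} f_i` with Euler letters `B_j = Σ_l C(a_{jl}(d_l − d_{l₀})) X^{d_l}` (the line's
`eulerNumerator d a l₀`, unfolded).  A row is SPLIT-SIGNED around `l₀` when its letters BELOW the coupled exponent are `≥ 0` and its
letters ABOVE are `≤ 0` (letters AT the coupled exponent are free): for `K = 3`, `l₀ = 1` these are the no-dip rows `(+, *, −)`; for
`l₀` the bottom letter they are the `(+, −, …, −)` rows (every-`K` T5 type), for `l₀` the top letter the `(+, …, +, −)`-mirror.

* `eulerLetter_eval_nonpos_of_splitSigned` — a split-signed row has a ONE-SIGNED Euler letter: `B_j(x) ≤ 0` for `x ≥ 0`;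
  `eulerLetter_eval_neg_of_splitSigned` — strictly `< 0` at `x > 0` as soon as the row has a non-zero letter off the coupled exponent.
* `eulerNumeratorK_eval_eq` — `R_{l₀}(x) = Σ_j B_j(x)·∏_{i≠j} f_i(x)` (evaluation bookkeeping).
* ★ `eulerNumeratorK_eval_nonpos_of_all_ahead` / `…_neg_of_all_ahead` — if every row is AHEAD at `x` (`f_i(x) > 0` for all `i`) then
  `R_{l₀}(x) ≤ 0`, and `< 0` when some row has a non-zero letter off the coupled exponent; ★ `eulerNumeratorK_eval_sign_of_all_passed` —
  if every row is PASSED at `x` (`f_i(x) < 0` for all `i`) then `(−1)^{m+1}·R_{l₀}(x) ≤ 0` (strict version alike).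
* ★★ `exists_passed_and_ahead_of_eulerNumeratorK_zero` — THE INTERACTION LAW (every `K`, any support, every coupling): at a positive zero
  `z` of `R_{l₀}` off the poles (`f_i(z) ≠ 0` for all `i`) of a split-signed company with a non-zero letter off the coupled exponent,
  SOME row is passed (`f_j(z) < 0`) and SOME row is ahead (`f_{j'}(z) > 0`): all positive zeros of the interior Euler numerator are
  interaction zeros, confined between the first and the last positive zero of `P = ∏ f_j` (which has at most `m` of them,
  ✓ `card_posRoots_prod_le_of_oneChangeK`).

HONEST FRAMING: sign bookkeeping for the every-`K` interior-coupling sector of the research stubs `stub_polyLaw` / `stub_eulerBoundK3`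
(the counting inside the interaction zone is the research content and is NOT touched); closes NO stub by name; NOT `OneChangeFloorK3`,
`EulerBoundK3`, `ClassRowK3Linear`, `PPOPolyLaw`, `ProductPlusOneMDR`, `MatrixDescartes`; `VP ≠ VNP` is NOT proved and nothing here bears on
it.  No definitions, no named facts, no sorry; Mathlib only.

[folklore] Elementary sign bookkeeping; no citation needed.
-/

set_option linter.dupNamespace false

namespace Summit.ValiantsHypothesis.ValiantsHypothesis.Theorems.LacunarySymmetroidMatrixDescartes

namespace ProductPlusOne

open Polynomial Finset
open scoped BigOperators

/-! ### §1 The Euler letter of a split-signed row is one-signed -/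

/-- Evaluation of an Euler letter. [folklore] -/
theorem eulerLetter_eval {K : ℕ} (d : Fin K → ℕ) (b : Fin K → ℝ) (l₀ : Fin K) (x : ℝ) :
    (∑ l, C (b l * ((d l : ℝ) - d l₀)) * X ^ (d l) : ℝ[X]).eval x = ∑ l, b l * ((d l : ℝ) - d l₀) * x ^ (d l) := by
  rw [eval_finsetSum]
  exact Finset.sum_congr rfl fun l _ => by rw [eval_mul, eval_C, eval_pow, eval_X]

/-- **A split-signed row has a one-signed Euler letter**: letters below the coupled exponent `≥ 0`, letters above `≤ 0`
⇒ `B(x) = Σ_l b_l (d_l − d_{l₀}) x^{d_l} ≤ 0` for every `x ≥ 0`. [folklore] -/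
theorem eulerLetter_eval_nonpos_of_splitSigned {K : ℕ} (d : Fin K → ℕ) (b : Fin K → ℝ) (l₀ : Fin K)
    (hlow : ∀ l, d l < d l₀ → 0 ≤ b l) (hup : ∀ l, d l₀ < d l → b l ≤ 0) {x : ℝ} (hx : 0 ≤ x) :
    (∑ l, C (b l * ((d l : ℝ) - d l₀)) * X ^ (d l) : ℝ[X]).eval x ≤ 0 := by
  rw [eulerLetter_eval]
  refine Finset.sum_nonpos fun l _ => ?_
  have hxp : 0 ≤ x ^ (d l) := pow_nonneg hx _
  rcases lt_trichotomy (d l) (d l₀) with h | h | h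
  · have h1 : ((d l : ℝ) - d l₀) < 0 := by
      have : (d l : ℝ) < d l₀ := by exact_mod_cast h
      linarith
    have : b l * ((d l : ℝ) - d l₀) ≤ 0 := mul_nonpos_of_nonneg_of_nonpos (hlow l h) h1.le
    exact mul_nonpos_of_nonpos_of_nonneg this hxp
  · rw [h, sub_self, mul_zero, zero_mul]
  · have h1 : 0 < ((d l : ℝ) - d l₀) := by
      have : (d l₀ : ℝ) < d l := by exact_mod_cast h
      linarith
    have : b l * ((d l : ℝ) - d l₀) ≤ 0 := mul_nonpos_of_nonpos_of_nonneg (hup l h) h1.le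
    exact mul_nonpos_of_nonpos_of_nonneg this hxp

/-- **Strict form**: if moreover some letter OFF the coupled exponent is non-zero, then `B(x) < 0` for every `x > 0`. [folklore] -/
theorem eulerLetter_eval_neg_of_splitSigned {K : ℕ} (d : Fin K → ℕ) (b : Fin K → ℝ) (l₀ : Fin K)
    (hlow : ∀ l, d l < d l₀ → 0 ≤ b l) (hup : ∀ l, d l₀ < d l → b l ≤ 0)
    (hnd : ∃ l, d l ≠ d l₀ ∧ b l ≠ 0) {x : ℝ} (hx : 0 < x) :
    (∑ l, C (b l * ((d l : ℝ) - d l₀)) * X ^ (d l) : ℝ[X]).eval x < 0 := by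
  rw [eulerLetter_eval]
  obtain ⟨l₁, hl₁, hb₁⟩ := hnd
  -- every term is `≤ 0`, the term `l₁` is `< 0`
  have hterm : ∀ l ∈ (Finset.univ : Finset (Fin K)), b l * ((d l : ℝ) - d l₀) * x ^ (d l) ≤ 0 := by
    intro l _
    have hxp : 0 ≤ x ^ (d l) := pow_nonneg hx.le _
    rcases lt_trichotomy (d l) (d l₀) with h | h | h
    · have h1 : ((d l : ℝ) - d l₀) < 0 := by
        have : (d l : ℝ) < d l₀ := by exact_mod_cast h
        linarith
      exact mul_nonpos_of_nonpos_of_nonneg (mul_nonpos_of_nonneg_of_nonpos (hlow l h) h1.le) hxp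
    · rw [h, sub_self, mul_zero, zero_mul]
    · have h1 : 0 < ((d l : ℝ) - d l₀) := by
        have : (d l₀ : ℝ) < d l := by exact_mod_cast h
        linarith
      exact mul_nonpos_of_nonpos_of_nonneg (mul_nonpos_of_nonpos_of_nonneg (hup l h) h1.le) hxp
  have hstrict : b l₁ * ((d l₁ : ℝ) - d l₀) * x ^ (d l₁) < 0 := by
    have hxp : 0 < x ^ (d l₁) := pow_pos hx _
    rcases lt_or_gt_of_ne hl₁ with h | h
    · have h1 : ((d l₁ : ℝ) - d l₀) < 0 := by
        have : (d l₁ : ℝ) < d l₀ := by exact_mod_cast h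
        linarith
      have hb : 0 < b l₁ := lt_of_le_of_ne (hlow l₁ h) (Ne.symm hb₁)
      exact mul_neg_of_neg_of_pos (mul_neg_of_pos_of_neg hb h1) hxp
    · have h1 : 0 < ((d l₁ : ℝ) - d l₀) := by
        have : (d l₀ : ℝ) < d l₁ := by exact_mod_cast h
        linarith
      have hb : b l₁ < 0 := lt_of_le_of_ne (hup l₁ h) hb₁
      exact mul_neg_of_neg_of_pos (mul_neg_of_neg_of_pos hb h1) hxp
  calc ∑ l, b l * ((d l : ℝ) - d l₀) * x ^ (d l)
      = b l₁ * ((d l₁ : ℝ) - d l₀) * x ^ (d l₁) + ∑ l ∈ Finset.univ.erase l₁, b l * ((d l : ℝ) - d l₀) * x ^ (d l) :=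
        (Finset.add_sum_erase _ _ (Finset.mem_univ l₁)).symm
    _ < 0 + 0 := by
        refine add_lt_add_of_lt_of_le hstrict ?_
        exact Finset.sum_nonpos fun l hl => hterm l (Finset.mem_univ l)
    _ = 0 := add_zero 0

/-! ### §2 The c-free Euler numerator at all-ahead / all-passed points -/

/-- Evaluation of the c-free Euler numerator: `R_{l₀}(x) = Σ_j B_j(x)·∏_{i≠j} f_i(x)`. [folklore] -/
theorem eulerNumeratorK_eval_eq {m K : ℕ} (d : Fin K → ℕ) (a : Fin m → Fin K → ℝ) (l₀ : Fin K) (x : ℝ) :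
    ((∑ j, (∑ l, C (a j l * ((d l : ℝ) - d l₀)) * X ^ (d l)) * ∏ i ∈ Finset.univ.erase j, (∑ l, C (a i l) * X ^ (d l))
        : ℝ[X]).eval x)
      = ∑ j, (∑ l, C (a j l * ((d l : ℝ) - d l₀)) * X ^ (d l) : ℝ[X]).eval x *
          ∏ i ∈ Finset.univ.erase j, (∑ l, C (a i l) * X ^ (d l) : ℝ[X]).eval x := by
  rw [eval_finsetSum]
  exact Finset.sum_congr rfl fun j _ => by rw [eval_mul, eval_prod]

/-- ★ **All rows AHEAD ⇒ `R_{l₀}(x) ≤ 0`**: a split-signed company (every row: letters below the coupled exponent `≥ 0`, above `≤ 0`)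
at a point `x ≥ 0` where every row is positive. [this file's theorem] -/
theorem eulerNumeratorK_eval_nonpos_of_all_ahead {m K : ℕ} (d : Fin K → ℕ) (a : Fin m → Fin K → ℝ) (l₀ : Fin K)
    (hlow : ∀ j l, d l < d l₀ → 0 ≤ a j l) (hup : ∀ j l, d l₀ < d l → a j l ≤ 0) {x : ℝ} (hx : 0 ≤ x)
    (hahead : ∀ i, 0 < (∑ l, C (a i l) * X ^ (d l) : ℝ[X]).eval x) :
    ((∑ j, (∑ l, C (a j l * ((d l : ℝ) - d l₀)) * X ^ (d l)) * ∏ i ∈ Finset.univ.erase j, (∑ l, C (a i l) * X ^ (d l))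
        : ℝ[X]).eval x) ≤ 0 := by
  rw [eulerNumeratorK_eval_eq]
  refine Finset.sum_nonpos fun j _ => ?_
  exact mul_nonpos_of_nonpos_of_nonneg (eulerLetter_eval_nonpos_of_splitSigned d (a j) l₀ (hlow j) (hup j) hx)
    (Finset.prod_nonneg fun i _ => (hahead i).le)

/-- ★ **All rows AHEAD, non-degenerate company ⇒ `R_{l₀}(x) < 0`** (`x > 0`; some row has a non-zero letter off the coupled exponent).
[this file's theorem] -/
theorem eulerNumeratorK_eval_neg_of_all_ahead {m K : ℕ} (d : Fin K → ℕ) (a : Fin m → Fin K → ℝ) (l₀ : Fin K)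
    (hlow : ∀ j l, d l < d l₀ → 0 ≤ a j l) (hup : ∀ j l, d l₀ < d l → a j l ≤ 0)
    (hnd : ∃ j l, d l ≠ d l₀ ∧ a j l ≠ 0) {x : ℝ} (hx : 0 < x)
    (hahead : ∀ i, 0 < (∑ l, C (a i l) * X ^ (d l) : ℝ[X]).eval x) :
    ((∑ j, (∑ l, C (a j l * ((d l : ℝ) - d l₀)) * X ^ (d l)) * ∏ i ∈ Finset.univ.erase j, (∑ l, C (a i l) * X ^ (d l))
        : ℝ[X]).eval x) < 0 := by
  rw [eulerNumeratorK_eval_eq]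
  obtain ⟨j₁, l₁, hl₁, ha₁⟩ := hnd
  have hterm : ∀ j ∈ (Finset.univ : Finset (Fin m)),
      (∑ l, C (a j l * ((d l : ℝ) - d l₀)) * X ^ (d l) : ℝ[X]).eval x *
        ∏ i ∈ Finset.univ.erase j, (∑ l, C (a i l) * X ^ (d l) : ℝ[X]).eval x ≤ 0 := fun j _ =>
    mul_nonpos_of_nonpos_of_nonneg (eulerLetter_eval_nonpos_of_splitSigned d (a j) l₀ (hlow j) (hup j) hx.le)
      (Finset.prod_nonneg fun i _ => (hahead i).le)
  have hstrict : (∑ l, C (a j₁ l * ((d l : ℝ) - d l₀)) * X ^ (d l) : ℝ[X]).eval x *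
        ∏ i ∈ Finset.univ.erase j₁, (∑ l, C (a i l) * X ^ (d l) : ℝ[X]).eval x < 0 :=
    mul_neg_of_neg_of_pos (eulerLetter_eval_neg_of_splitSigned d (a j₁) l₀ (hlow j₁) (hup j₁) ⟨l₁, hl₁, ha₁⟩ hx)
      (Finset.prod_pos fun i _ => hahead i)
  calc ∑ j, (∑ l, C (a j l * ((d l : ℝ) - d l₀)) * X ^ (d l) : ℝ[X]).eval x *
          ∏ i ∈ Finset.univ.erase j, (∑ l, C (a i l) * X ^ (d l) : ℝ[X]).eval x
      = (∑ l, C (a j₁ l * ((d l : ℝ) - d l₀)) * X ^ (d l) : ℝ[X]).eval x *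
          ∏ i ∈ Finset.univ.erase j₁, (∑ l, C (a i l) * X ^ (d l) : ℝ[X]).eval x
        + ∑ j ∈ Finset.univ.erase j₁, (∑ l, C (a j l * ((d l : ℝ) - d l₀)) * X ^ (d l) : ℝ[X]).eval x *
          ∏ i ∈ Finset.univ.erase j, (∑ l, C (a i l) * X ^ (d l) : ℝ[X]).eval x :=
        (Finset.add_sum_erase _ _ (Finset.mem_univ j₁)).symm
    _ < 0 + 0 := add_lt_add_of_lt_of_le hstrict (Finset.sum_nonpos fun j _ => hterm j (Finset.mem_univ j))
    _ = 0 := add_zero 0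

/-- ★ **All rows PASSED ⇒ `(−1)^(m+1)·R_{l₀}(x) ≤ 0`** (every row negative at `x ≥ 0`; each product of the `m − 1` other rows has the
sign `(−1)^(m−1)`). [this file's theorem] -/
theorem eulerNumeratorK_eval_sign_of_all_passed {m K : ℕ} (d : Fin K → ℕ) (a : Fin m → Fin K → ℝ) (l₀ : Fin K)
    (hlow : ∀ j l, d l < d l₀ → 0 ≤ a j l) (hup : ∀ j l, d l₀ < d l → a j l ≤ 0) {x : ℝ} (hx : 0 ≤ x)
    (hpassed : ∀ i, (∑ l, C (a i l) * X ^ (d l) : ℝ[X]).eval x < 0) :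
    (-1 : ℝ) ^ (m + 1) *
      ((∑ j, (∑ l, C (a j l * ((d l : ℝ) - d l₀)) * X ^ (d l)) * ∏ i ∈ Finset.univ.erase j, (∑ l, C (a i l) * X ^ (d l))
        : ℝ[X]).eval x) ≤ 0 := by
  classical
  rw [eulerNumeratorK_eval_eq, Finset.mul_sum]
  refine Finset.sum_nonpos fun j _ => ?_
  -- `(−1)^(m+1) · ∏_{i≠j} f_i(x) = (−1)^(m+1) · (−1)^(m−1) · ∏ |f_i(x)| ≥ 0`
  have hprod : 0 ≤ (-1 : ℝ) ^ (m + 1) * ∏ i ∈ Finset.univ.erase j, (∑ l, C (a i l) * X ^ (d l) : ℝ[X]).eval x := by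
    have hcard : (Finset.univ.erase j).card = m - 1 := by
      rw [Finset.card_erase_of_mem (Finset.mem_univ j), Finset.card_univ, Fintype.card_fin]
    have heq : ∏ i ∈ Finset.univ.erase j, (∑ l, C (a i l) * X ^ (d l) : ℝ[X]).eval x
        = (-1 : ℝ) ^ (m - 1) * ∏ i ∈ Finset.univ.erase j, (-((∑ l, C (a i l) * X ^ (d l) : ℝ[X]).eval x)) := by
      rw [Finset.prod_neg, hcard, ← mul_assoc, ← mul_pow, neg_one_mul, neg_neg, one_pow, one_mul]
    rw [heq, ← mul_assoc, ← pow_add]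
    have hm : 1 ≤ m := by
      rcases Nat.eq_zero_or_pos m with h0 | h0
      · subst h0; exact absurd j.2 (Nat.not_lt_zero _)
      · exact h0
    have heven : Even (m + 1 + (m - 1)) := ⟨m, by omega⟩
    rw [heven.neg_one_pow, one_mul]
    exact Finset.prod_nonneg fun i _ => by linarith [hpassed i]
  have hB := eulerLetter_eval_nonpos_of_splitSigned d (a j) l₀ (hlow j) (hup j) hx
  calc (-1 : ℝ) ^ (m + 1) * ((∑ l, C (a j l * ((d l : ℝ) - d l₀)) * X ^ (d l) : ℝ[X]).eval x *
          ∏ i ∈ Finset.univ.erase j, (∑ l, C (a i l) * X ^ (d l) : ℝ[X]).eval x)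
      = (∑ l, C (a j l * ((d l : ℝ) - d l₀)) * X ^ (d l) : ℝ[X]).eval x *
          ((-1 : ℝ) ^ (m + 1) * ∏ i ∈ Finset.univ.erase j, (∑ l, C (a i l) * X ^ (d l) : ℝ[X]).eval x) := by ring
    _ ≤ 0 := mul_nonpos_of_nonpos_of_nonneg hB hprod

/-! ### §3 The interaction law -/

/-- ★★ **THE INTERACTION LAW** (every `K`, any support, every coupling `l₀`): at a positive zero `z` of the c-free Euler numerator
of a split-signed company, off the poles and with some non-zero letter off the coupled exponent, SOME row is passed (`f_j(z) < 0`) and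
SOME row is ahead (`f_{j'}(z) > 0`). [this file's theorem] -/
theorem exists_passed_and_ahead_of_eulerNumeratorK_zero {m K : ℕ} (d : Fin K → ℕ) (a : Fin m → Fin K → ℝ) (l₀ : Fin K)
    (hlow : ∀ j l, d l < d l₀ → 0 ≤ a j l) (hup : ∀ j l, d l₀ < d l → a j l ≤ 0)
    (hnd : ∃ j l, d l ≠ d l₀ ∧ a j l ≠ 0) {z : ℝ} (hz : 0 < z)
    (hpole : ∀ i, (∑ l, C (a i l) * X ^ (d l) : ℝ[X]).eval z ≠ 0)
    (hzero : ((∑ j, (∑ l, C (a j l * ((d l : ℝ) - d l₀)) * X ^ (d l)) *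
        ∏ i ∈ Finset.univ.erase j, (∑ l, C (a i l) * X ^ (d l)) : ℝ[X]).eval z) = 0) :
    (∃ j, (∑ l, C (a j l) * X ^ (d l) : ℝ[X]).eval z < 0) ∧ (∃ j, 0 < (∑ l, C (a j l) * X ^ (d l) : ℝ[X]).eval z) := by
  classical
  constructor
  · by_contra hno
    push Not at hno
    have hahead : ∀ i, 0 < (∑ l, C (a i l) * X ^ (d l) : ℝ[X]).eval z :=
      fun i => lt_of_le_of_ne (hno i) (Ne.symm (hpole i))
    have h := eulerNumeratorK_eval_neg_of_all_ahead d a l₀ hlow hup hnd hz hahead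
    rw [hzero] at h
    exact lt_irrefl _ h
  · by_contra hno
    push Not at hno
    have hpassed : ∀ i, (∑ l, C (a i l) * X ^ (d l) : ℝ[X]).eval z < 0 :=
      fun i => lt_of_le_of_ne (hno i) (hpole i)
    -- strict all-passed sign: the row `j₁` term is strictly negative after the `(−1)^(m+1)` twist
    obtain ⟨j₁, l₁, hl₁, ha₁⟩ := hnd
    have hterm : ∀ j ∈ (Finset.univ : Finset (Fin m)), (-1 : ℝ) ^ (m + 1) *
        ((∑ l, C (a j l * ((d l : ℝ) - d l₀)) * X ^ (d l) : ℝ[X]).eval z *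
          ∏ i ∈ Finset.univ.erase j, (∑ l, C (a i l) * X ^ (d l) : ℝ[X]).eval z) ≤ 0 := by
      intro j _
      have hcard : (Finset.univ.erase j).card = m - 1 := by
        rw [Finset.card_erase_of_mem (Finset.mem_univ j), Finset.card_univ, Fintype.card_fin]
      have heq : ∏ i ∈ Finset.univ.erase j, (∑ l, C (a i l) * X ^ (d l) : ℝ[X]).eval z
          = (-1 : ℝ) ^ (m - 1) * ∏ i ∈ Finset.univ.erase j, (-((∑ l, C (a i l) * X ^ (d l) : ℝ[X]).eval z)) := by
        rw [Finset.prod_neg, hcard, ← mul_assoc, ← mul_pow, neg_one_mul, neg_neg, one_pow, one_mul]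
      have hm : 1 ≤ m := by
        rcases Nat.eq_zero_or_pos m with h0 | h0
        · subst h0; exact absurd j.2 (Nat.not_lt_zero _)
        · exact h0
      have heven : Even (m + 1 + (m - 1)) := ⟨m, by omega⟩
      have hprod : 0 ≤ (-1 : ℝ) ^ (m + 1) * ∏ i ∈ Finset.univ.erase j, (∑ l, C (a i l) * X ^ (d l) : ℝ[X]).eval z := by
        rw [heq, ← mul_assoc, ← pow_add, heven.neg_one_pow, one_mul]
        exact Finset.prod_nonneg fun i _ => by linarith [hpassed i]
      have hB := eulerLetter_eval_nonpos_of_splitSigned d (a j) l₀ (hlow j) (hup j) hz.le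
      calc (-1 : ℝ) ^ (m + 1) * ((∑ l, C (a j l * ((d l : ℝ) - d l₀)) * X ^ (d l) : ℝ[X]).eval z *
              ∏ i ∈ Finset.univ.erase j, (∑ l, C (a i l) * X ^ (d l) : ℝ[X]).eval z)
          = (∑ l, C (a j l * ((d l : ℝ) - d l₀)) * X ^ (d l) : ℝ[X]).eval z *
              ((-1 : ℝ) ^ (m + 1) * ∏ i ∈ Finset.univ.erase j, (∑ l, C (a i l) * X ^ (d l) : ℝ[X]).eval z) := by ring
        _ ≤ 0 := mul_nonpos_of_nonpos_of_nonneg hB hprod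
    have hstrict : (-1 : ℝ) ^ (m + 1) *
        ((∑ l, C (a j₁ l * ((d l : ℝ) - d l₀)) * X ^ (d l) : ℝ[X]).eval z *
          ∏ i ∈ Finset.univ.erase j₁, (∑ l, C (a i l) * X ^ (d l) : ℝ[X]).eval z) < 0 := by
      have hcard : (Finset.univ.erase j₁).card = m - 1 := by
        rw [Finset.card_erase_of_mem (Finset.mem_univ j₁), Finset.card_univ, Fintype.card_fin]
      have heq : ∏ i ∈ Finset.univ.erase j₁, (∑ l, C (a i l) * X ^ (d l) : ℝ[X]).eval z
          = (-1 : ℝ) ^ (m - 1) * ∏ i ∈ Finset.univ.erase j₁, (-((∑ l, C (a i l) * X ^ (d l) : ℝ[X]).eval z)) := by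
        rw [Finset.prod_neg, hcard, ← mul_assoc, ← mul_pow, neg_one_mul, neg_neg, one_pow, one_mul]
      have hm : 1 ≤ m := by
        rcases Nat.eq_zero_or_pos m with h0 | h0
        · subst h0; exact absurd j₁.2 (Nat.not_lt_zero _)
        · exact h0
      have heven : Even (m + 1 + (m - 1)) := ⟨m, by omega⟩
      have hprod : 0 < (-1 : ℝ) ^ (m + 1) * ∏ i ∈ Finset.univ.erase j₁, (∑ l, C (a i l) * X ^ (d l) : ℝ[X]).eval z := by
        rw [heq, ← mul_assoc, ← pow_add, heven.neg_one_pow, one_mul]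
        exact Finset.prod_pos fun i _ => by linarith [hpassed i]
      have hB := eulerLetter_eval_neg_of_splitSigned d (a j₁) l₀ (hlow j₁) (hup j₁) ⟨l₁, hl₁, ha₁⟩ hz
      calc (-1 : ℝ) ^ (m + 1) * ((∑ l, C (a j₁ l * ((d l : ℝ) - d l₀)) * X ^ (d l) : ℝ[X]).eval z *
              ∏ i ∈ Finset.univ.erase j₁, (∑ l, C (a i l) * X ^ (d l) : ℝ[X]).eval z)
          = (∑ l, C (a j₁ l * ((d l : ℝ) - d l₀)) * X ^ (d l) : ℝ[X]).eval z *
              ((-1 : ℝ) ^ (m + 1) * ∏ i ∈ Finset.univ.erase j₁, (∑ l, C (a i l) * X ^ (d l) : ℝ[X]).eval z) := by ring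
        _ < 0 := mul_neg_of_neg_of_pos hB hprod
    have hsum : (-1 : ℝ) ^ (m + 1) *
        ((∑ j, (∑ l, C (a j l * ((d l : ℝ) - d l₀)) * X ^ (d l)) *
          ∏ i ∈ Finset.univ.erase j, (∑ l, C (a i l) * X ^ (d l)) : ℝ[X]).eval z) < 0 := by
      rw [eulerNumeratorK_eval_eq, Finset.mul_sum, ← Finset.add_sum_erase _ _ (Finset.mem_univ j₁)]
      calc _ < 0 + 0 := add_lt_add_of_lt_of_le hstrict (Finset.sum_nonpos fun j _ => hterm j (Finset.mem_univ j))
        _ = 0 := add_zero 0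
    rw [hzero, mul_zero] at hsum
    exact lt_irrefl _ hsum

end ProductPlusOne

end Summit.ValiantsHypothesis.ValiantsHypothesis.Theorems.LacunarySymmetroidMatrixDescartes
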